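import Summits.Ventures.LatticeQCDFlow.Scoring.UNOnePlaquetteCumulants
import HarnessLib

/-!
# The range and STRICT monotonicity of the `U(N)` one-plaquette plaquette: `P_N(0) = 0`, `P_N` odd, `−1 < P_N < 1`, `P_N' > 0`

HONEST FRAMING: exact (Metropolis-corrected) sampling algorithms for lattice gauge theory;
figures of merit are autocorrelation/cost numbers at stated couplings and volumes; no
continuum-physics claim.

Venture `LatticeQCDFlow` (cell pub-lqcd), sub-topic `Scoring`; FANOUT row 5 (`s0-sun-a`), GEN-17.
NEW WORK of the cell (placement rule).  The sanity envelope of theory-2's `U(N)` one-plaquette plaquette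
`P_N(β) := ∫ (1/N) Re tr U e^{−β(N − Re tr U)} dU / ∫ e^{−β(N − Re tr U)} dU` (Haar measure on `U(N)`), for every
`N ≥ 1`, complementing `OnePlaquetteHaarMGF` (monotone), `UNOnePlaquetteCumulants` (slope `1/(2N)` at `0`, limit
`1` at `+∞`, variance `= (log det)''/N²`) and `UNOnePlaquettePlaquetteBessel` (the Bessel formula):

* §1 ABSTRACT tilted-law bounds on a finite measure space, for a bounded observable `X` and a level `M > 0`
  (`w = e^{−β(M−X)}`): `∫ (X/M) w / ∫ w < 1` if `X ≤ M` and `{X < M}` is non-null; `> −1` if `−M ≤ X` and `{−M < X}`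
  is non-null; and the tilted VARIANCE `∫ (X/M)² w/∫ w − (∫ (X/M) w/∫ w)² > 0` if moreover every `{M − ε < X}` is
  non-null (`tilted_ratio_lt_one`, `neg_one_lt_tilted_ratio`, `tilted_variance_pos`);
* §2 `P_N(0) = 0`; `P_N ≥ 0` on `β ≥ 0`, `≤ 0` on `β ≤ 0`; **`P_N(−β) = −P_N(β)`** (`det[I_{|i−j|}]` is even);
* §3 `{Re tr U < N}` is Haar-non-null (contains `−1`); **`−1 < P_N(β) < 1`**;
* §4 **`P_N'(β) = (1/N)(log det[I_{|i−j|}])''(β) = N·Var_β > 0`: `P_N` is STRICTLY increasing**, so `P_N(β) > 0` for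
  `β > 0` (GEN-16's `OnePlaquetteBesselRatioMonotone` gave `U(1)`, `SU(2)` non-strictly).

No `def`, nothing cited as a fact, 0 sorry.
-/

noncomputable section

open Real MeasureTheory Filter Topology Finset Complex Set
open scoped ENNReal
open ProbabilityTheory
open Literature.MathematicalPhysics.QuantumFieldTheory
open Literature.MathematicalPhysics.QuantumLattice
open Literature.Analysis.FunctionSpaces

namespace Summit.Ventures.LatticeQCDFlow.Scoring

/-! ### 1. Abstract tilted-law bounds -/

section Abstract

variable {Ω : Type*} [MeasurableSpace Ω] {μ : Measure Ω} [IsFiniteMeasure μ] {X : Ω → ℝ} {C M : ℝ}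

/-- Integrability of the tilted weight `e^{−β(M − X)}` for bounded `X`. -/
theorem integrable_exp_neg_mul_sub (hX : AEStronglyMeasurable X μ) (hC : ∀ ω, |X ω| ≤ C) (M β : ℝ) :
    Integrable (fun ω => Real.exp (-(β * (M - X ω)))) μ := by
  have h := (integrable_exp_mul_of_abs_le_const hX hC β).const_mul (Real.exp (-(M * β)))
  refine h.congr (Filter.Eventually.of_forall fun ω => ?_)
  show Real.exp (-(M * β)) * Real.exp (β * X ω) = Real.exp (-(β * (M - X ω)))
  rw [← Real.exp_add]; congr 1; ring

omit [IsFiniteMeasure μ] in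
/-- A bounded a.e.-strongly measurable factor preserves integrability. -/
theorem integrable_mul_of_abs_le_const (hX : AEStronglyMeasurable X μ) (hC : ∀ ω, |X ω| ≤ C) {f : Ω → ℝ}
    (hf : Integrable f μ) : Integrable (fun ω => X ω * f ω) μ :=
  Integrable.mono' (hf.norm.const_mul C) (hX.mul hf.aestronglyMeasurable)
    (Filter.Eventually.of_forall fun ω => by
      rw [Real.norm_eq_abs, abs_mul, Real.norm_eq_abs]; exact mul_le_mul_of_nonneg_right (hC ω) (abs_nonneg _))

/-- **Tilted ratio `< 1`**: if `X ≤ M`, `M > 0` and `{X < M}` is `μ`-non-null, then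
`∫ (X/M) e^{−β(M−X)} dμ / ∫ e^{−β(M−X)} dμ < 1`. -/
theorem tilted_ratio_lt_one (hX : AEStronglyMeasurable X μ) (hC : ∀ ω, |X ω| ≤ C) (hM : 0 < M)
    (hle : ∀ ω, X ω ≤ M) (hpos : 0 < μ {ω | X ω < M}) (β : ℝ) :
    (∫ ω, X ω / M * Real.exp (-(β * (M - X ω))) ∂μ) / (∫ ω, Real.exp (-(β * (M - X ω))) ∂μ) < 1 := by
  have hw_int := integrable_exp_neg_mul_sub hX hC M β
  have hXw_int := integrable_mul_of_abs_le_const hX hC hw_int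
  haveI : NeZero μ := ⟨fun h => by rw [h] at hpos; simp at hpos⟩
  have hZ : 0 < ∫ ω, Real.exp (-(β * (M - X ω))) ∂μ := integral_exp_pos hw_int
  have hg_int : Integrable (fun ω => (M - X ω) * Real.exp (-(β * (M - X ω)))) μ := by
    refine ((hw_int.const_mul M).sub hXw_int).congr (Filter.Eventually.of_forall fun ω => ?_)
    simp only [Pi.sub_apply]; ring
  have hgap : 0 < ∫ ω, (M - X ω) * Real.exp (-(β * (M - X ω))) ∂μ := by
    rw [integral_pos_iff_support_of_nonneg (fun ω => mul_nonneg (sub_nonneg.2 (hle ω)) (Real.exp_pos _).le) hg_int]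
    refine hpos.trans_le (measure_mono fun ω hω => ?_)
    simp only [Set.mem_setOf_eq] at hω
    exact (mul_pos (sub_pos.2 hω) (Real.exp_pos _)).ne'
  have hsplit : ∫ ω, (M - X ω) * Real.exp (-(β * (M - X ω))) ∂μ
      = M * ∫ ω, Real.exp (-(β * (M - X ω))) ∂μ - ∫ ω, X ω * Real.exp (-(β * (M - X ω))) ∂μ := by
    rw [← integral_const_mul, ← integral_sub (hw_int.const_mul _) hXw_int]
    exact integral_congr_ae (Filter.Eventually.of_forall fun ω => by simp only; ring)
  have hrw : ∫ ω, X ω / M * Real.exp (-(β * (M - X ω))) ∂μ = (1 / M) * ∫ ω, X ω * Real.exp (-(β * (M - X ω))) ∂μ := by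
    rw [← integral_const_mul]
    exact integral_congr_ae (Filter.Eventually.of_forall fun ω => by simp only; ring)
  rw [div_lt_one hZ, hrw]
  rw [hsplit] at hgap
  calc 1 / M * ∫ ω, X ω * Real.exp (-(β * (M - X ω))) ∂μ
      < 1 / M * (M * ∫ ω, Real.exp (-(β * (M - X ω))) ∂μ) := mul_lt_mul_of_pos_left (by linarith) (by positivity)
    _ = ∫ ω, Real.exp (-(β * (M - X ω))) ∂μ := by field_simp

/-- **Tilted ratio `> −1`**: if `−M ≤ X`, `M > 0` and `{−M < X}` is `μ`-non-null, then
`−1 < ∫ (X/M) e^{−β(M−X)} dμ / ∫ e^{−β(M−X)} dμ`. -/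
theorem neg_one_lt_tilted_ratio (hX : AEStronglyMeasurable X μ) (hC : ∀ ω, |X ω| ≤ C) (hM : 0 < M)
    (hge : ∀ ω, -M ≤ X ω) (hpos : 0 < μ {ω | -M < X ω}) (β : ℝ) :
    -1 < (∫ ω, X ω / M * Real.exp (-(β * (M - X ω))) ∂μ) / (∫ ω, Real.exp (-(β * (M - X ω))) ∂μ) := by
  have hw_int := integrable_exp_neg_mul_sub hX hC M β
  have hXw_int := integrable_mul_of_abs_le_const hX hC hw_int
  haveI : NeZero μ := ⟨fun h => by rw [h] at hpos; simp at hpos⟩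
  have hZ : 0 < ∫ ω, Real.exp (-(β * (M - X ω))) ∂μ := integral_exp_pos hw_int
  have hg_int : Integrable (fun ω => (M + X ω) * Real.exp (-(β * (M - X ω)))) μ := by
    refine ((hw_int.const_mul M).add hXw_int).congr (Filter.Eventually.of_forall fun ω => ?_)
    simp only [Pi.add_apply]; ring
  have hgap : 0 < ∫ ω, (M + X ω) * Real.exp (-(β * (M - X ω))) ∂μ := by
    rw [integral_pos_iff_support_of_nonneg (fun ω => mul_nonneg (by linarith [hge ω]) (Real.exp_pos _).le) hg_int]
    refine hpos.trans_le (measure_mono fun ω hω => ?_)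
    simp only [Set.mem_setOf_eq] at hω
    exact (mul_pos (by linarith) (Real.exp_pos _)).ne'
  have hsplit : ∫ ω, (M + X ω) * Real.exp (-(β * (M - X ω))) ∂μ
      = M * ∫ ω, Real.exp (-(β * (M - X ω))) ∂μ + ∫ ω, X ω * Real.exp (-(β * (M - X ω))) ∂μ := by
    rw [← integral_const_mul, ← integral_add (hw_int.const_mul _) hXw_int]
    exact integral_congr_ae (Filter.Eventually.of_forall fun ω => by simp only; ring)
  have hrw : ∫ ω, X ω / M * Real.exp (-(β * (M - X ω))) ∂μ = (1 / M) * ∫ ω, X ω * Real.exp (-(β * (M - X ω))) ∂μ := by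
    rw [← integral_const_mul]
    exact integral_congr_ae (Filter.Eventually.of_forall fun ω => by simp only; ring)
  rw [hrw, lt_div_iff₀ hZ]
  rw [hsplit] at hgap
  calc (-1 : ℝ) * ∫ ω, Real.exp (-(β * (M - X ω))) ∂μ
      = 1 / M * (-(M * ∫ ω, Real.exp (-(β * (M - X ω))) ∂μ)) := by field_simp
    _ < 1 / M * ∫ ω, X ω * Real.exp (-(β * (M - X ω))) ∂μ := mul_lt_mul_of_pos_left (by linarith) (by positivity)

/-- **Tilted variance `> 0`**: if `X ≤ M`, `M > 0`, `{X < M}` is non-null and every `{M − ε < X}` (`ε > 0`) is non-null,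
then `∫ (X/M)² w / ∫ w − (∫ (X/M) w / ∫ w)² > 0` for `w = e^{−β(M−X)}` (the tilted law of `X/M` is not a point mass). -/
theorem tilted_variance_pos (hX : AEStronglyMeasurable X μ) (hC : ∀ ω, |X ω| ≤ C) (hM : 0 < M)
    (hle : ∀ ω, X ω ≤ M) (hlt : 0 < μ {ω | X ω < M}) (hgt : ∀ ε : ℝ, 0 < ε → 0 < μ {ω | M - ε < X ω}) (β : ℝ) :
    0 < (∫ ω, (X ω / M) ^ 2 * Real.exp (-(β * (M - X ω))) ∂μ) / (∫ ω, Real.exp (-(β * (M - X ω))) ∂μ)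
      - ((∫ ω, X ω / M * Real.exp (-(β * (M - X ω))) ∂μ) / (∫ ω, Real.exp (-(β * (M - X ω))) ∂μ)) ^ 2 := by
  have hP1 := tilted_ratio_lt_one hX hC hM hle hlt β
  have hw_int := integrable_exp_neg_mul_sub hX hC M β
  have hXw := integrable_mul_of_abs_le_const hX hC hw_int
  have hXXw := integrable_mul_of_abs_le_const hX hC hXw
  haveI : NeZero μ := ⟨fun h => by rw [h] at hlt; simp at hlt⟩
  have hZ : 0 < ∫ ω, Real.exp (-(β * (M - X ω))) ∂μ := integral_exp_pos hw_int
  have hI1 : ∫ ω, X ω / M * Real.exp (-(β * (M - X ω))) ∂μ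
      = (1 / M) * ∫ ω, X ω * Real.exp (-(β * (M - X ω))) ∂μ := by
    rw [← integral_const_mul]
    exact integral_congr_ae (Filter.Eventually.of_forall fun ω => by simp only; ring)
  have hI2 : ∫ ω, (X ω / M) ^ 2 * Real.exp (-(β * (M - X ω))) ∂μ
      = (1 / M ^ 2) * ∫ ω, X ω * (X ω * Real.exp (-(β * (M - X ω)))) ∂μ := by
    rw [← integral_const_mul]
    exact integral_congr_ae (Filter.Eventually.of_forall fun ω => by simp only; ring)
  rw [hI1] at hP1
  rw [hI1, hI2]
  -- abbreviations
  obtain ⟨Z, hZdef⟩ : ∃ Z, Z = ∫ ω, Real.exp (-(β * (M - X ω))) ∂μ := ⟨_, rfl⟩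
  obtain ⟨A, hAdef⟩ : ∃ A, A = ∫ ω, X ω * Real.exp (-(β * (M - X ω))) ∂μ := ⟨_, rfl⟩
  obtain ⟨B, hBdef⟩ : ∃ B, B = ∫ ω, X ω * (X ω * Real.exp (-(β * (M - X ω)))) ∂μ := ⟨_, rfl⟩
  rw [← hZdef, ← hAdef] at hP1 ⊢
  rw [← hBdef]
  rw [← hZdef] at hZ
  have hAZ : A < M * Z := by
    rw [div_lt_one hZ] at hP1
    have := mul_lt_mul_of_pos_left hP1 hM
    field_simp at this
    linarith
  have hc : A / Z < M := by rwa [div_lt_iff₀ hZ]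
  -- the centred second moment
  have e : ∀ ω, (X ω - A / Z) ^ 2 * Real.exp (-(β * (M - X ω)))
      = X ω * (X ω * Real.exp (-(β * (M - X ω)))) - (2 * (A / Z)) * (X ω * Real.exp (-(β * (M - X ω))))
        + (A / Z) ^ 2 * Real.exp (-(β * (M - X ω))) := by
    intro ω; ring
  have hV_int : Integrable (fun ω => (X ω - A / Z) ^ 2 * Real.exp (-(β * (M - X ω)))) μ := by
    simp_rw [e]; exact (hXXw.sub (hXw.const_mul _)).add (hw_int.const_mul _)
  have hV : ∫ ω, (X ω - A / Z) ^ 2 * Real.exp (-(β * (M - X ω))) ∂μ = B - 2 * (A / Z) * A + (A / Z) ^ 2 * Z := by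
    simp_rw [e]
    have h1 : Integrable (fun ω => X ω * (X ω * Real.exp (-(β * (M - X ω))))
        - 2 * (A / Z) * (X ω * Real.exp (-(β * (M - X ω))))) μ := hXXw.sub (hXw.const_mul _)
    rw [integral_add h1 (hw_int.const_mul _), integral_sub hXXw (hXw.const_mul _),
      integral_const_mul, integral_const_mul, ← hZdef, ← hAdef, ← hBdef]
  have hVpos : 0 < ∫ ω, (X ω - A / Z) ^ 2 * Real.exp (-(β * (M - X ω))) ∂μ := by
    rw [integral_pos_iff_support_of_nonneg (fun ω => mul_nonneg (sq_nonneg _) (Real.exp_pos _).le) hV_int]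
    refine (hgt (M - A / Z) (by linarith)).trans_le (measure_mono fun ω hω => ?_)
    simp only [Set.mem_setOf_eq] at hω
    simp only [Function.mem_support]
    have hω' : 0 < X ω - A / Z := by linarith
    exact (mul_pos (pow_pos hω' 2) (Real.exp_pos _)).ne'
  have hBZ : 0 < B * Z - A ^ 2 := by
    have h : B * Z - A ^ 2 = Z * ∫ ω, (X ω - A / Z) ^ 2 * Real.exp (-(β * (M - X ω))) ∂μ := by
      rw [hV]; field_simp; ring
    rw [h]; exact mul_pos hZ hVpos
  have hfin : 1 / M ^ 2 * B / Z - (1 / M * A / Z) ^ 2 = (B * Z - A ^ 2) / (M ^ 2 * Z ^ 2) := by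
    field_simp
  rw [hfin]
  exact div_pos hBZ (by positivity)

end Abstract

/-! ### 2. `P_N(0) = 0`, the sign of `P_N`, and oddness -/

/-- **`P_N(0) = 0`**: at `β = 0` the plaquette is `(1/N) ∫_{U(N)} Re tr U dU = 0`. -/
theorem unitary_plaquette_zero (N : ℕ) :
    (∫ u, ((u : Matrix.unitaryGroup (Fin N) ℂ) : Matrix (Fin N) (Fin N) ℂ).trace.re / N *
          Real.exp (-((0 : ℝ) * ((N : ℝ) - ((u : Matrix.unitaryGroup (Fin N) ℂ) : Matrix (Fin N) (Fin N) ℂ).trace.re)))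
        ∂(haarProbability (Matrix.unitaryGroup (Fin N) ℂ)))
      / (∫ u, Real.exp (-((0 : ℝ) * ((N : ℝ) - ((u : Matrix.unitaryGroup (Fin N) ℂ) :
          Matrix (Fin N) (Fin N) ℂ).trace.re))) ∂(haarProbability (Matrix.unitaryGroup (Fin N) ℂ))) = 0 := by
  rw [unitary_plaquette_eq_deriv_log_det, deriv_log_det_besselI_toeplitz_zero, mul_zero]

/-- `P_N(β) ≥ 0` for `β ≥ 0` (monotone and `P_N(0) = 0`). -/
theorem unitary_plaquette_nonneg (N : ℕ) {β : ℝ} (hβ : 0 ≤ β) :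
    0 ≤ (∫ u, ((u : Matrix.unitaryGroup (Fin N) ℂ) : Matrix (Fin N) (Fin N) ℂ).trace.re / N *
          Real.exp (-(β * ((N : ℝ) - ((u : Matrix.unitaryGroup (Fin N) ℂ) : Matrix (Fin N) (Fin N) ℂ).trace.re)))
        ∂(haarProbability (Matrix.unitaryGroup (Fin N) ℂ)))
      / (∫ u, Real.exp (-(β * ((N : ℝ) - ((u : Matrix.unitaryGroup (Fin N) ℂ) :
          Matrix (Fin N) (Fin N) ℂ).trace.re))) ∂(haarProbability (Matrix.unitaryGroup (Fin N) ℂ))) := by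
  have h := monotone_unitary_plaquette N hβ
  dsimp only at h
  rwa [unitary_plaquette_zero] at h

/-- `P_N(β) ≤ 0` for `β ≤ 0`. -/
theorem unitary_plaquette_nonpos (N : ℕ) {β : ℝ} (hβ : β ≤ 0) :
    (∫ u, ((u : Matrix.unitaryGroup (Fin N) ℂ) : Matrix (Fin N) (Fin N) ℂ).trace.re / N *
          Real.exp (-(β * ((N : ℝ) - ((u : Matrix.unitaryGroup (Fin N) ℂ) : Matrix (Fin N) (Fin N) ℂ).trace.re)))
        ∂(haarProbability (Matrix.unitaryGroup (Fin N) ℂ)))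
      / (∫ u, Real.exp (-(β * ((N : ℝ) - ((u : Matrix.unitaryGroup (Fin N) ℂ) :
          Matrix (Fin N) (Fin N) ℂ).trace.re))) ∂(haarProbability (Matrix.unitaryGroup (Fin N) ℂ))) ≤ 0 := by
  have h := monotone_unitary_plaquette N hβ
  dsimp only at h
  rwa [unitary_plaquette_zero] at h

/-- **`P_N(−β) = −P_N(β)`**: `det[I_{|i−j|}(x)]` is even in `x`, so its logarithmic derivative is odd. -/
theorem unitary_plaquette_neg (N : ℕ) (β : ℝ) :
    (∫ u, ((u : Matrix.unitaryGroup (Fin N) ℂ) : Matrix (Fin N) (Fin N) ℂ).trace.re / N *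
          Real.exp (-((-β) * ((N : ℝ) - ((u : Matrix.unitaryGroup (Fin N) ℂ) : Matrix (Fin N) (Fin N) ℂ).trace.re)))
        ∂(haarProbability (Matrix.unitaryGroup (Fin N) ℂ)))
      / (∫ u, Real.exp (-((-β) * ((N : ℝ) - ((u : Matrix.unitaryGroup (Fin N) ℂ) :
          Matrix (Fin N) (Fin N) ℂ).trace.re))) ∂(haarProbability (Matrix.unitaryGroup (Fin N) ℂ)))
      = -((∫ u, ((u : Matrix.unitaryGroup (Fin N) ℂ) : Matrix (Fin N) (Fin N) ℂ).trace.re / N *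
          Real.exp (-(β * ((N : ℝ) - ((u : Matrix.unitaryGroup (Fin N) ℂ) : Matrix (Fin N) (Fin N) ℂ).trace.re)))
        ∂(haarProbability (Matrix.unitaryGroup (Fin N) ℂ)))
      / (∫ u, Real.exp (-(β * ((N : ℝ) - ((u : Matrix.unitaryGroup (Fin N) ℂ) :
          Matrix (Fin N) (Fin N) ℂ).trace.re))) ∂(haarProbability (Matrix.unitaryGroup (Fin N) ℂ)))) := by
  rw [unitary_plaquette_eq_deriv_log_det, unitary_plaquette_eq_deriv_log_det]
  have h : deriv (fun x : ℝ => Real.log (Matrix.of fun i j : Fin N => besselI ((i : ℤ) - (j : ℤ)).natAbs (-x)).det) β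
      = -deriv (fun x : ℝ => Real.log (Matrix.of fun i j : Fin N => besselI ((i : ℤ) - (j : ℤ)).natAbs x).det) (-β) :=
    deriv_comp_neg (fun x : ℝ => Real.log (Matrix.of fun i j : Fin N => besselI ((i : ℤ) - (j : ℤ)).natAbs x).det) β
  simp only [det_besselI_toeplitz_neg] at h
  rw [show deriv (fun x : ℝ => Real.log (Matrix.of fun i j : Fin N => besselI ((i : ℤ) - (j : ℤ)).natAbs x).det) (-β)
      = -deriv (fun x : ℝ => Real.log (Matrix.of fun i j : Fin N => besselI ((i : ℤ) - (j : ℤ)).natAbs x).det) β by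
    rw [h, neg_neg]]
  ring

/-! ### 3. `−1 < P_N(β) < 1` -/

/-- The set `{Re tr U < N}` has positive Haar measure in `U(N)`, `N ≥ 1` (it is open and contains `−1`). -/
theorem haar_unitaryGroup_trace_re_lt_card_pos (N : ℕ) [NeZero N] :
    0 < haarProbability (Matrix.unitaryGroup (Fin N) ℂ)
      {u | ((u : Matrix.unitaryGroup (Fin N) ℂ) : Matrix (Fin N) (Fin N) ℂ).trace.re < N} := by
  haveI : (haarProbability (Matrix.unitaryGroup (Fin N) ℂ)).IsHaarMeasure := Measure.isHaarMeasure_haarMeasure ⊤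
  have hopen : IsOpen {u : Matrix.unitaryGroup (Fin N) ℂ |
      ((u : Matrix.unitaryGroup (Fin N) ℂ) : Matrix (Fin N) (Fin N) ℂ).trace.re < N} :=
    isOpen_lt (Complex.continuous_re.comp (continuous_id.matrix_trace.comp continuous_subtype_val)) continuous_const
  refine hopen.measure_pos _ ⟨-1, ?_⟩
  simp only [Set.mem_setOf_eq]
  rw [Unitary.coe_neg, show (((1 : Matrix.unitaryGroup (Fin N) ℂ)) : Matrix (Fin N) (Fin N) ℂ) = 1 from rfl,
    Matrix.trace_neg, Matrix.trace_one, Complex.neg_re]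
  simp only [Complex.natCast_re, Fintype.card_fin]
  have hN : (0 : ℝ) < N := Nat.cast_pos.2 (Nat.pos_of_neZero N)
  linarith

/-- **`P_N(β) < 1`** for every real `β` and `N ≥ 1`. -/
theorem unitary_plaquette_lt_one (N : ℕ) [NeZero N] (β : ℝ) :
    (∫ u, ((u : Matrix.unitaryGroup (Fin N) ℂ) : Matrix (Fin N) (Fin N) ℂ).trace.re / N *
          Real.exp (-(β * ((N : ℝ) - ((u : Matrix.unitaryGroup (Fin N) ℂ) : Matrix (Fin N) (Fin N) ℂ).trace.re)))
        ∂(haarProbability (Matrix.unitaryGroup (Fin N) ℂ)))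
      / (∫ u, Real.exp (-(β * ((N : ℝ) - ((u : Matrix.unitaryGroup (Fin N) ℂ) :
          Matrix (Fin N) (Fin N) ℂ).trace.re))) ∂(haarProbability (Matrix.unitaryGroup (Fin N) ℂ))) < 1 :=
  tilted_ratio_lt_one (μ := haarProbability (Matrix.unitaryGroup (Fin N) ℂ))
    (aestronglyMeasurable_trace_re_unitaryGroup N) (fun u => abs_trace_re_le_card u)
    (Nat.cast_pos.2 (Nat.pos_of_neZero N)) (fun u => by simpa [Fintype.card_fin] using trace_re_le_card u)
    (haar_unitaryGroup_trace_re_lt_card_pos N) β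

/-- **`−1 < P_N(β)`** for every real `β` and `N ≥ 1` (oddness and `P_N(−β) < 1`). -/
theorem neg_one_lt_unitary_plaquette (N : ℕ) [NeZero N] (β : ℝ) :
    -1 < (∫ u, ((u : Matrix.unitaryGroup (Fin N) ℂ) : Matrix (Fin N) (Fin N) ℂ).trace.re / N *
          Real.exp (-(β * ((N : ℝ) - ((u : Matrix.unitaryGroup (Fin N) ℂ) : Matrix (Fin N) (Fin N) ℂ).trace.re)))
        ∂(haarProbability (Matrix.unitaryGroup (Fin N) ℂ)))
      / (∫ u, Real.exp (-(β * ((N : ℝ) - ((u : Matrix.unitaryGroup (Fin N) ℂ) :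
          Matrix (Fin N) (Fin N) ℂ).trace.re))) ∂(haarProbability (Matrix.unitaryGroup (Fin N) ℂ))) := by
  have h := unitary_plaquette_lt_one N (-β)
  rw [unitary_plaquette_neg] at h
  linarith

/-! ### 4. Strict monotonicity: `P_N' = (1/N)(log det)'' = N · Var > 0` -/

/-- **The tilted plaquette variance is positive**: `⟨((1/N) Re tr U)²⟩_β − ⟨(1/N) Re tr U⟩_β² > 0` (`N ≥ 1`). -/
theorem unitary_plaquette_variance_pos (N : ℕ) [NeZero N] (β : ℝ) :
    0 < (∫ u, (((u : Matrix.unitaryGroup (Fin N) ℂ) : Matrix (Fin N) (Fin N) ℂ).trace.re / N) ^ 2 *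
          Real.exp (-(β * ((N : ℝ) - ((u : Matrix.unitaryGroup (Fin N) ℂ) : Matrix (Fin N) (Fin N) ℂ).trace.re)))
        ∂(haarProbability (Matrix.unitaryGroup (Fin N) ℂ)))
      / (∫ u, Real.exp (-(β * ((N : ℝ) - ((u : Matrix.unitaryGroup (Fin N) ℂ) : Matrix (Fin N) (Fin N) ℂ).trace.re)))
        ∂(haarProbability (Matrix.unitaryGroup (Fin N) ℂ)))
      - ((∫ u, ((u : Matrix.unitaryGroup (Fin N) ℂ) : Matrix (Fin N) (Fin N) ℂ).trace.re / N *
          Real.exp (-(β * ((N : ℝ) - ((u : Matrix.unitaryGroup (Fin N) ℂ) : Matrix (Fin N) (Fin N) ℂ).trace.re)))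
        ∂(haarProbability (Matrix.unitaryGroup (Fin N) ℂ)))
      / (∫ u, Real.exp (-(β * ((N : ℝ) - ((u : Matrix.unitaryGroup (Fin N) ℂ) : Matrix (Fin N) (Fin N) ℂ).trace.re)))
        ∂(haarProbability (Matrix.unitaryGroup (Fin N) ℂ)))) ^ 2 :=
  tilted_variance_pos (μ := haarProbability (Matrix.unitaryGroup (Fin N) ℂ))
    (aestronglyMeasurable_trace_re_unitaryGroup N) (fun u => abs_trace_re_le_card u)
    (Nat.cast_pos.2 (Nat.pos_of_neZero N)) (fun u => by simpa [Fintype.card_fin] using trace_re_le_card u)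
    (haar_unitaryGroup_trace_re_lt_card_pos N) (fun ε hε => haar_unitaryGroup_trace_re_gt_pos N hε) β

/-- `P_N` is differentiable with **`P_N'(β) = (1/N)(log det[I_{|i−j|}])''(β)`**. -/
theorem hasDerivAt_unitary_plaquette (N : ℕ) (β : ℝ) :
    HasDerivAt (fun β : ℝ =>
      (∫ u, ((u : Matrix.unitaryGroup (Fin N) ℂ) : Matrix (Fin N) (Fin N) ℂ).trace.re / N *
          Real.exp (-(β * ((N : ℝ) - ((u : Matrix.unitaryGroup (Fin N) ℂ) : Matrix (Fin N) (Fin N) ℂ).trace.re)))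
        ∂(haarProbability (Matrix.unitaryGroup (Fin N) ℂ)))
      / (∫ u, Real.exp (-(β * ((N : ℝ) - ((u : Matrix.unitaryGroup (Fin N) ℂ) : Matrix (Fin N) (Fin N) ℂ).trace.re)))
        ∂(haarProbability (Matrix.unitaryGroup (Fin N) ℂ))))
      (1 / N * iteratedDeriv 2 (fun x : ℝ =>
        Real.log (Matrix.of fun i j : Fin N => besselI ((i : ℤ) - (j : ℤ)).natAbs x).det) β) β := by
  simp_rw [unitary_plaquette_eq_deriv_log_det]
  have ha := analyticOnNhd_cgf_univ (aestronglyMeasurable_trace_re_unitaryGroup N) (fun u => abs_trace_re_le_card u)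
  have hcgf : (fun x : ℝ => Real.log (Matrix.of fun i j : Fin N => besselI ((i : ℤ) - (j : ℤ)).natAbs x).det)
      = cgf (fun u : Matrix.unitaryGroup (Fin N) ℂ => ((u : Matrix.unitaryGroup (Fin N) ℂ) :
          Matrix (Fin N) (Fin N) ℂ).trace.re) (haarProbability (Matrix.unitaryGroup (Fin N) ℂ)) :=
    funext fun x => by rw [cgf, mgf_trace_re_unitaryGroup]
  rw [iteratedDeriv_succ, iteratedDeriv_one]
  have hd : HasDerivAt (deriv fun x : ℝ =>
      Real.log (Matrix.of fun i j : Fin N => besselI ((i : ℤ) - (j : ℤ)).natAbs x).det)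
      (deriv (deriv fun x : ℝ =>
        Real.log (Matrix.of fun i j : Fin N => besselI ((i : ℤ) - (j : ℤ)).natAbs x).det) β) β := by
    rw [hcgf]
    exact ((ha β (Set.mem_univ β)).deriv).differentiableAt.hasDerivAt
  exact hd.const_mul (1 / (N : ℝ))

/-- **`P_N'(β) > 0`** for every real `β` and `N ≥ 1`. -/
theorem deriv_unitary_plaquette_pos (N : ℕ) [NeZero N] (β : ℝ) :
    0 < deriv (fun β : ℝ =>
      (∫ u, ((u : Matrix.unitaryGroup (Fin N) ℂ) : Matrix (Fin N) (Fin N) ℂ).trace.re / N *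
          Real.exp (-(β * ((N : ℝ) - ((u : Matrix.unitaryGroup (Fin N) ℂ) : Matrix (Fin N) (Fin N) ℂ).trace.re)))
        ∂(haarProbability (Matrix.unitaryGroup (Fin N) ℂ)))
      / (∫ u, Real.exp (-(β * ((N : ℝ) - ((u : Matrix.unitaryGroup (Fin N) ℂ) : Matrix (Fin N) (Fin N) ℂ).trace.re)))
        ∂(haarProbability (Matrix.unitaryGroup (Fin N) ℂ)))) β := by
  rw [(hasDerivAt_unitary_plaquette N β).deriv]
  have hpos := unitary_plaquette_variance_pos N β
  rw [unitary_plaquette_variance_eq] at hpos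
  have hN : (0 : ℝ) < N := Nat.cast_pos.2 (Nat.pos_of_neZero N)
  have h2 : 0 < iteratedDeriv 2 (fun x : ℝ =>
      Real.log (Matrix.of fun i j : Fin N => besselI ((i : ℤ) - (j : ℤ)).natAbs x).det) β :=
    (mul_pos_iff_of_pos_left (by positivity)).1 hpos
  positivity

/-- **THE `U(N)` ONE-PLAQUETTE PLAQUETTE IS STRICTLY INCREASING IN THE COUPLING**, for every `N ≥ 1`. -/
theorem strictMono_unitary_plaquette (N : ℕ) [NeZero N] :
    StrictMono fun β : ℝ =>
      (∫ u, ((u : Matrix.unitaryGroup (Fin N) ℂ) : Matrix (Fin N) (Fin N) ℂ).trace.re / N *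
          Real.exp (-(β * ((N : ℝ) - ((u : Matrix.unitaryGroup (Fin N) ℂ) : Matrix (Fin N) (Fin N) ℂ).trace.re)))
        ∂(haarProbability (Matrix.unitaryGroup (Fin N) ℂ)))
      / (∫ u, Real.exp (-(β * ((N : ℝ) - ((u : Matrix.unitaryGroup (Fin N) ℂ) : Matrix (Fin N) (Fin N) ℂ).trace.re)))
        ∂(haarProbability (Matrix.unitaryGroup (Fin N) ℂ))) :=
  strictMono_of_deriv_pos fun β => deriv_unitary_plaquette_pos N β

/-- `P_N(β) > 0` for `β > 0` and `P_N(β) < 0` for `β < 0` (`N ≥ 1`). -/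
theorem unitary_plaquette_pos (N : ℕ) [NeZero N] {β : ℝ} (hβ : 0 < β) :
    0 < (∫ u, ((u : Matrix.unitaryGroup (Fin N) ℂ) : Matrix (Fin N) (Fin N) ℂ).trace.re / N *
          Real.exp (-(β * ((N : ℝ) - ((u : Matrix.unitaryGroup (Fin N) ℂ) : Matrix (Fin N) (Fin N) ℂ).trace.re)))
        ∂(haarProbability (Matrix.unitaryGroup (Fin N) ℂ)))
      / (∫ u, Real.exp (-(β * ((N : ℝ) - ((u : Matrix.unitaryGroup (Fin N) ℂ) :
          Matrix (Fin N) (Fin N) ℂ).trace.re))) ∂(haarProbability (Matrix.unitaryGroup (Fin N) ℂ))) := by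
  have h := strictMono_unitary_plaquette N hβ
  dsimp only at h
  rwa [unitary_plaquette_zero] at h

end Summit.Ventures.LatticeQCDFlow.Scoring
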